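import Summits.AtomisticToContinuum.HydrodynamicLimit.Theorems.InformationPercolationEngineKickFairRelEquilibriumMesoNoLastCollision
import Summits.AtomisticToContinuum.HydrodynamicLimit.Theorems.InformationPercolationEngineKickFairRelEquilibriumMesoTransferAE
import Literature.MathematicalPhysics.KineticTheory.CollisionTubePullbackFlight
import Literature.Analysis.FluidPDE.HardSphereRegularGeometry
import HarnessLib

/-!
# `KickFairRelEquilibriumMeso`, line `Sketch` — the PRE-COLLISIONAL VELOCITIES ARE PAST-MEASURABLE; velocity-only kick
# observables are exactly fair (crux stmt-AtomisticToContinuum-15177; `--supports`; continuation lead c4, 2026-08-16)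

Helper file of the line `Cruxes/KickFairRelEquilibriumMeso/Lines/Sketch.lean` (rev 10: `crux ⇐ U ∧ RU`). The kick datum of the
crux is `X_{i,n} = (ω, v⁻, v*⁻)` (impact vector and the two pre-collisional velocities of the `n`-th collision of sphere `i`),
and its typed past `P_{i,n}` records the coarse positions and the EXACT velocities of all spheres at the two flight starts
`s_i, s_q` together with the partner label `q` and the times. This file machine-checks the remark made on paper by every
refuter of the lineage ("`g = g(v⁻, v*⁻)` gives defect `≡ 0` exactly"):

* `kick_snd_eq_readPast` (deterministic, on the good set, at a genuine collision `t_{i,n} > 0`): the pre-collisional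
  velocities ARE read off the past, `(v⁻, v*⁻) = (velocity of i in the first photo, velocity of q in the second photo)` —
  the flight of `i` is free on `(s_i, t_{i,n})` and that of `q` on `(s_q, t_{i,n})` (`not_participates_of_mem_Ioo_flightStart`),
  velocities are right-continuous and constant along a free flight (`leftLim_orbit_vel_eq`), and the recorded pre-velocities are
  the left limits (`ofConfig_preVel_eq_leftLim`).
* `ae_kick_snd_eq_kappa_of_lt_cnt`: consequently, under the invariant law `G`, for a velocity-only observable `g(ω, v, w) = gv(v, w)`
  the equilibrium centring is trivial on the crux's cut: `G`-a.e., `n < cnt_i(τ) → g(X_{i,n}) = κ_{i,n}` (the cut is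
  `{t_{i,n} ∈ (0, τ]}` a.e. by `ae_lt_cnt_iff_mem_Ioc`, a past-measurable event, and on it `g(X)` is a measurable function of `P`;
  `condExp_indicator` + `condExp_of_stronglyMeasurable`).
* `slotSum_velocityOnly_ae_eq_zero`: every windowed kick sum of a velocity-only observable vanishes `G`-a.e.; hence
  `restartDeviationCut_velocityOnly` (registered sub-goal): the rev 10 stub RU `stub_restartDeviationCut` HOLDS for velocity-only
  observables, for every flow, with `c = η = 1`, `N₀ = 0`.

So the entire content of RU (and of the crux) is the conditional law of the IMPACT VECTOR `ω` given the mesoscopic past.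
All hypotheses are explicit binders; no named `Prop` is taken as a fact.
-/

noncomputable section

open MeasureTheory Set Filter Topology Function
open scoped ENNReal Classical

namespace Summit.AtomisticToContinuum.HydrodynamicLimit.Theorems.KickFairRelEquilibriumMesoLine

open Literature.Analysis.FluidPDE Literature.MathematicalPhysics.KineticTheory

variable {σ : ℝ} {N : ℕ}

/-! ## Reading the pre-collisional velocities off the typed past -/

/-- **The pre-collisional velocities are read off the past (deterministic).** On the good set, if the `n`-th collision time
`t = t_{i,n}` of `i` is a genuine collision time of `i` with `t > 0`, then the recorded pre-collisional velocities of the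
collision are the velocity of `i` at its flight start `s_i` and the velocity of the partner `q` at its flight start `s_q`, i.e.
`(kick Φ i n z).2 = (((past Φ r z i n).1.1.1 i).2, ((past Φ r z i n).1.1.2 (past Φ r z i n).1.2).2)`. [folklore] -/
theorem kick_snd_eq_readPast (Φ : Flow σ N) (hε : hsDiameter σ N < 2⁻¹) (r : ℝ) {z : Phase N} (hz : z ∈ Φ.good)
    (i : Fin (N + 1)) (n : ℕ)
    (hgen : Φ.nthCollisionTimeOf i n z ∈
      collisionTimesOf (Torus.geometry (Fin 3)) (hsDiameter σ N) (fun s => Φ.flow s z) i)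
    (hpos : 0 < Φ.nthCollisionTimeOf i n z) :
    (kick Φ i n z).2 = (((past Φ r z i n).1.1.1 i).2, ((past Φ r z i n).1.1.2 (past Φ r z i n).1.2).2) := by
  set t : ℝ := Φ.nthCollisionTimeOf i n z with ht
  set j : Fin (N + 1) := Φ.nthPartnerOf i n z with hj
  have htraj := Φ.isTrajectory z hz
  have hG := Torus.isHardSphereRegular_geometry (d := Fin 3) hε
  -- `(i, j)` is an ordered contact pair at time `t`
  have hpart : Participates (Torus.geometry (Fin 3)) (hsDiameter σ N) (Φ.flow t z) i := hgen
  have hcoll : Collide (Torus.geometry (Fin 3)) (hsDiameter σ N) (Φ.flow t z) i j := collide_partner hpart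
  have hp : (i, j) ∈ contactPairs (Torus.geometry (Fin 3)) (hsDiameter σ N) (Φ.flow t z) := by
    rcases hcoll with h | h
    · exact h
    · exact (swap_mem_contactPairs_iff hG (p := (i, j))).1 h
  -- the recorded pre-velocities are the left limits
  have h1 : (kick Φ i n z).2 = ((leftLim (fun s => Φ.flow s z) t i).2, (leftLim (fun s => Φ.flow s z) t j).2) := by
    have := htraj.ofConfig_preVel_eq_leftLim hp
    simpa only [kick, hz, if_true, HardSphereFlow.nthRecordOf] using this
  -- the flights of `i` and `j` ending at `t` are free
  set si : ℝ := flightStart (Torus.geometry (Fin 3)) (hsDiameter σ N) (fun s => Φ.flow s z) 0 i t with hsi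
  set sj : ℝ := flightStart (Torus.geometry (Fin 3)) (hsDiameter σ N) (fun s => Φ.flow s z) 0 j t with hsj
  have hsi_lt : si < t := flightStart_lt (htraj.finite_collisionTimesOf_inter_Ioo i 0 t) hpos
  have hsj_lt : sj < t := flightStart_lt (htraj.finite_collisionTimesOf_inter_Ioo j 0 t) hpos
  have hi_free : ∀ u ∈ Ioo si t,
      ¬ Participates (Torus.geometry (Fin 3)) (hsDiameter σ N) (orbit σ N Φ z u) i := fun u hu =>
    htraj.not_participates_of_mem_Ioo_flightStart hu
  have hj_free : ∀ u ∈ Ioo sj t,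
      ¬ Participates (Torus.geometry (Fin 3)) (hsDiameter σ N) (orbit σ N Φ z u) j := fun u hu =>
    htraj.not_participates_of_mem_Ioo_flightStart hu
  have hli : (leftLim (fun s => Φ.flow s z) t i).2 = (Φ.flow si z i).2 := leftLim_orbit_vel_eq hz i hsi_lt hi_free
  have hlj : (leftLim (fun s => Φ.flow s z) t j).2 = (Φ.flow sj z j).2 := leftLim_orbit_vel_eq hz j hsj_lt hj_free
  rw [h1, hli, hlj]
  simp only [past, hz, if_true, HardSphereFlow.coarsePastOf, coarseConfig, hsi, hsj, ht, hj]

/-! ## Consequence under the invariant law: velocity-only observables are exactly fair on the cut -/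

/-- **For a velocity-only observable the equilibrium centring is trivial on the cut**: under the invariant law
`G = localGibbsLaw σ 1 0 1 N Φ` (`0 < σ < 1/2`), for `g(ω, v, w) = gv(v, w)` with `gv` continuous and bounded, `G`-a.e.,
`n < cnt_i(τ) → g(X_{i,n}) = κ_{i,n}`. Proof: a.e. the cut is the past-measurable event `A = {t_{i,n} ∈ (0, τ]}`
(`ae_lt_cnt_iff_mem_Ioc`), on `A` the collision is genuine and `g(X)` is `gv` of the read-out of `P` (`kick_snd_eq_readPast`), so
`1_A κ = G[1_A g(X) | σ(P)] = 1_A · gv(read-out of P)` a.e. [folklore] -/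
theorem ae_kick_snd_eq_kappa_of_lt_cnt (hPM : PastMeasurable) (hσ : 0 < σ) (hσ2 : σ < 1 / 2) (Φ : Flow σ N) (τ r : ℝ)
    {gv : V3 × V3 → ℝ} (hgv : Continuous gv) (hgb : ∃ C : ℝ, ∀ p, |gv p| ≤ C) (i : Fin (N + 1)) (n : ℕ) :
    ∀ᵐ z ∂(localGibbsLaw σ (fun _ => 1) (fun _ => 0) (fun _ => 1) N Φ),
      n < cnt Φ τ z i → gv (kick Φ i n z).2 = kappa Φ r (fun x => gv x.2) i n z := by
  obtain ⟨C, hC⟩ := hgb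
  set ν : Measure (Phase N) := localGibbsLaw σ (fun _ => (1 : ℝ)) (fun _ => (0 : V3)) (fun _ => (1 : ℝ)) N Φ with hν
  haveI : IsProbabilityMeasure ν := isProbabilityMeasure_localGibbsLaw continuous_const continuous_const
    continuous_const (fun _ => one_pos) (fun _ => one_pos) hσ2.le N Φ
  have hε : hsDiameter σ N < 2⁻¹ := by
    have := hsDiameter_le hσ.le N
    rw [inv_eq_one_div]; linarith
  -- the σ-algebra of the past (written out: a `set` would shadow the Borel instance) and the past-measurable
  -- event `A = {t_{i,n} ∈ (0, τ]}`
  have hPm : Measurable (fun z => past Φ r z i n) := (hPM σ hσ N Φ r 0 i n).1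
  have hmle : MeasurableSpace.comap (fun z => past Φ r z i n) inferInstance ≤
      (inferInstance : MeasurableSpace (Phase N)) := comap_past_le hPM hσ Φ r i n
  have hPm' : Measurable[MeasurableSpace.comap (fun z => past Φ r z i n) inferInstance] (fun z => past Φ r z i n) :=
    measurable_iff_comap_le.2 le_rfl
  set S : Set (Past N) := {p | p.2.2.2 ∈ Ioc 0 τ} with hS
  have hSm : MeasurableSet S := (measurable_snd.comp (measurable_snd.comp measurable_snd)) measurableSet_Ioc
  set A : Set (Phase N) := (fun z => past Φ r z i n) ⁻¹' S with hA
  have hAm : MeasurableSet[MeasurableSpace.comap (fun z => past Φ r z i n) inferInstance] A := hPm' hSm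
  -- the two functions
  set f : Phase N → ℝ := fun z => gv (kick Φ i n z).2 with hf
  set φ : Phase N → ℝ := fun z =>
    gv (((past Φ r z i n).1.1.1 i).2, ((past Φ r z i n).1.1.2 (past Φ r z i n).1.2).2) with hφ
  have hfm : Measurable f := hgv.measurable.comp (measurable_snd.comp (hPM σ hσ N Φ r 0 i n).2.1)
  -- the read-out `p ↦ ((p.1.1.1 i).2, (p.1.1.2 p.1.2).2)` is measurable (evaluation at a finitely-valued index)
  have hread : Measurable (fun p : Past N => ((p.1.1.1 i).2, (p.1.1.2 p.1.2).2)) := by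
    refine Measurable.prodMk ?_ ?_
    · exact measurable_snd.comp ((measurable_pi_apply i).comp (measurable_fst.comp (measurable_fst.comp measurable_fst)))
    · have hidx : Measurable (fun p : Past N => p.1.2) := measurable_snd.comp measurable_fst
      have hfun : Measurable (fun p : Past N => p.1.1.2) := measurable_snd.comp (measurable_fst.comp measurable_fst)
      have heval : Measurable (fun q : (Fin (N + 1) → (Fin 3 → ℤ) × V3) × Fin (N + 1) => q.1 q.2) :=
        measurable_from_prod_countable_left fun j => measurable_pi_apply j
      exact measurable_snd.comp (heval.comp (hfun.prodMk hidx))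
  have hφm' : Measurable[MeasurableSpace.comap (fun z => past Φ r z i n) inferInstance] φ :=
    hgv.measurable.comp (hread.comp hPm')
  have hfi : Integrable f ν := Integrable.of_bound hfm.aestronglyMeasurable C
    (Eventually.of_forall fun z => by rw [Real.norm_eq_abs]; exact hC _)
  have hφi : Integrable φ ν := Integrable.of_bound (hφm'.mono hmle le_rfl).aestronglyMeasurable C
    (Eventually.of_forall fun z => by rw [Real.norm_eq_abs]; exact hC _)
  -- a.e.: the cut is `A`, and on `A` the kick is read off the past
  have hgood : ∀ᵐ z ∂ν, z ∈ Φ.good := mem_ae_iff.2 (localGibbsLaw_compl_good_eq_zero Φ)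
  have hcut : ∀ᵐ z ∂ν, ∀ n : ℕ, n < cnt Φ τ z i ↔ Φ.nthCollisionTimeOf i n z ∈ Ioc 0 τ :=
    ae_lt_cnt_iff_mem_Ioc one_pos one_pos (0 : V3) hσ2.le Φ τ i
  have hAiff : ∀ᵐ z ∂ν, z ∈ A ↔ n < cnt Φ τ z i := by
    filter_upwards [hgood, hcut] with z hz hc
    rw [hc n, hA, mem_preimage, hS, mem_setOf_eq]
    simp only [past, hz, if_true]
  have hfφ : ∀ᵐ z ∂ν, z ∈ A → f z = φ z := by
    filter_upwards [hgood, hAiff] with z hz hzA hzmem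
    have hlt : n < cnt Φ τ z i := hzA.1 hzmem
    have hmem := nthTimeAfter_mem_of_lt_ncard (S := collisionTimesOf (Torus.geometry (Fin 3)) (hsDiameter σ N)
      (fun s => Φ.flow s z) i) (a := 0) (b := τ) hlt
    simp only [hf, hφ]
    rw [kick_snd_eq_readPast Φ hε r hz i n hmem.1 hmem.2.1]
  -- indicators
  have hind : A.indicator f =ᵐ[ν] A.indicator φ := by
    filter_upwards [hfφ] with z hz
    by_cases hzA : z ∈ A
    · simp only [indicator_of_mem hzA, hz hzA]
    · simp only [indicator_of_notMem hzA]
  have h1 : ν[A.indicator f|MeasurableSpace.comap (fun z => past Φ r z i n) inferInstance] =ᵐ[ν]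
      A.indicator (ν[f|MeasurableSpace.comap (fun z => past Φ r z i n) inferInstance]) :=
    condExp_indicator hfi hAm
  have h2 : ν[A.indicator f|MeasurableSpace.comap (fun z => past Φ r z i n) inferInstance] =ᵐ[ν]
      ν[A.indicator φ|MeasurableSpace.comap (fun z => past Φ r z i n) inferInstance] :=
    condExp_congr_ae hind
  have h3 : ν[A.indicator φ|MeasurableSpace.comap (fun z => past Φ r z i n) inferInstance] = A.indicator φ := by
    refine condExp_of_stronglyMeasurable hmle ?_ (hφi.indicator (hmle _ hAm))
    exact (hφm'.indicator hAm).stronglyMeasurable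
  have hκ : kappa Φ r (fun x => gv x.2) i n = ν[f|MeasurableSpace.comap (fun z => past Φ r z i n) inferInstance] := rfl
  filter_upwards [h1, h2, hAiff, hfφ] with z hz1 hz2 hzA hzf hlt
  have hzmem : z ∈ A := hzA.2 hlt
  have e1 : A.indicator (ν[f|MeasurableSpace.comap (fun z => past Φ r z i n) inferInstance]) z = A.indicator φ z := by
    rw [← hz1, hz2, h3]
  rw [indicator_of_mem hzmem, indicator_of_mem hzmem] at e1
  rw [hκ]
  change f z = (ν[f|MeasurableSpace.comap (fun z => past Φ r z i n) inferInstance]) z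
  rw [e1, hzf hzmem]

/-- **Windowed kick sums of velocity-only observables vanish a.e. under the invariant law** (every summand has
`g(X_{i,n}) − κ_{i,n} = 0` on the cut, `ae_kick_snd_eq_kappa_of_lt_cnt`). [folklore] -/
theorem slotSum_velocityOnly_ae_eq_zero (hPM : PastMeasurable) (hσ : 0 < σ) (hσ2 : σ < 1 / 2) (Φ : Flow σ N)
    (τ r t₁ t₂ : ℝ) {gv : V3 × V3 → ℝ} (hgv : Continuous gv) (hgb : ∃ C : ℝ, ∀ p, |gv p| ≤ C)
    (h : Fin (N + 1) → ℕ → Past N → ℝ) :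
    ∀ᵐ z ∂(localGibbsLaw σ (fun _ => 1) (fun _ => 0) (fun _ => 1) N Φ),
      slotSum Φ τ r t₁ t₂ (fun x => gv x.2) h z = 0 := by
  have hall : ∀ᵐ z ∂(localGibbsLaw σ (fun _ => 1) (fun _ => 0) (fun _ => 1) N Φ),
      ∀ i : Fin (N + 1), ∀ n : ℕ, n < cnt Φ τ z i → gv (kick Φ i n z).2 = kappa Φ r (fun x => gv x.2) i n z := by
    rw [ae_all_iff]; intro i
    rw [ae_all_iff]; intro n
    exact ae_kick_snd_eq_kappa_of_lt_cnt hPM hσ hσ2 Φ τ r hgv hgb i n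
  filter_upwards [hall] with z hz
  unfold slotSum
  refine mul_eq_zero_of_right _ (Finset.sum_eq_zero fun i _ => Finset.sum_eq_zero fun n hn => ?_)
  simp only [hz i n (Finset.mem_range.1 hn), sub_self, mul_zero]

/-- **RU for velocity-only observables (registered sub-goal `restartDeviationCut_velocityOnly`).** The rev 10 stub
`stub_restartDeviationCut` of line `Sketch`, restricted to observables `g(ω, v, w) = gv(v, w)` of the pre-collisional velocities
alone, HOLDS — for every flow family, with `σ₀ = 1/2`, `c = η = 1`, `N₀ = 0`: the cut windowed kick sum vanishes `G`-a.e.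
(`slotSum_velocityOnly_ae_eq_zero`), so the deviation event is `G`-null. The Borel plumbing M is an explicit hypothesis. [folklore] -/
theorem restartDeviationCut_velocityOnly :
    PastMeasurable →
    ∀ (a₀ θ₀ : T3 → ℝ) (u₀ : T3 → V3), Continuous a₀ → Continuous θ₀ → Continuous u₀ →
    (∀ x, 0 < a₀ x) → (∀ x, 0 < θ₀ x) →
    ∃ σ₀ : ℝ, 0 < σ₀ ∧ ∀ σ : ℝ, 0 < σ → σ < σ₀ → ∀ Φ : (N : ℕ) → Flow σ N, ∀ τ : ℝ, 0 < τ →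
    ∀ gv : V3 × V3 → ℝ, Continuous gv → (∃ C : ℝ, ∀ p, |gv p| ≤ C) →
    ∀ L : ℝ, 0 < L → ∀ A : ℝ, 0 < A →
    ∃ c : ℝ, 0 < c ∧ ∃ η : ℝ, 0 < η ∧ ∃ N₀ : ℕ, ∀ N : ℕ, N₀ ≤ N →
    ∀ h : Fin (N + 1) → ℕ → Past N → ℝ, (∀ i n, Measurable (h i n)) → (∀ i n p, |h i n p| ≤ 1) →
    (∀ i n p, p.2.2.2 - p.2.1 < tN N / A → h i n p = 0) →
    ∀ t₁ t₂ : ℝ, 0 ≤ t₁ → t₁ ≤ t₂ → t₂ ≤ τ → t₂ ≤ t₁ + tN N →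
    ∀ z₀ : Phase N,
    ENNReal.ofReal (Real.exp (-(η * ((N : ℝ) + 1)))) ≤
        localGibbsLaw σ a₀ u₀ θ₀ N (Φ N) {z | cellKey (rs N) (rs N) z = cellKey (rs N) (rs N) z₀} →
      localGibbsLaw σ (fun _ => 1) (fun _ => 0) (fun _ => 1) N (Φ N)
          ({z | cellKey (rs N) (rs N) z = cellKey (rs N) (rs N) z₀} ∩
            {z | tN N / L < |slotSum (Φ N) τ (rs N) t₁ t₂ (fun x => gv x.2) h z|}) ≤
        ENNReal.ofReal (Real.exp (-(1 * ((N : ℝ) + 1)))) *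
          localGibbsLaw σ (fun _ => 1) (fun _ => 0) (fun _ => 1) N (Φ N)
            {z | cellKey (rs N) (rs N) z = cellKey (rs N) (rs N) z₀} := by
  intro hPM a₀ θ₀ u₀ _ _ _ _ _
  refine ⟨1 / 2, by norm_num, fun σ hσ hσ2 Φ τ _ gv hgv hgb L hL A _ => ?_⟩
  refine ⟨1, one_pos, 1, one_pos, 0, fun N _ h _ _ _ t₁ t₂ _ _ _ _ z₀ _ => ?_⟩
  have hz := slotSum_velocityOnly_ae_eq_zero hPM hσ hσ2 (Φ N) τ (rs N) t₁ t₂ hgv hgb h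
  have hnull : localGibbsLaw σ (fun _ => 1) (fun _ => 0) (fun _ => 1) N (Φ N)
      {z | tN N / L < |slotSum (Φ N) τ (rs N) t₁ t₂ (fun x => gv x.2) h z|} = 0 := by
    rw [← compl_compl {z | tN N / L < |slotSum (Φ N) τ (rs N) t₁ t₂ (fun x => gv x.2) h z|}, ← mem_ae_iff]
    filter_upwards [hz] with z hz
    simp only [mem_compl_iff, mem_setOf_eq, hz, abs_zero, not_lt]
    exact div_nonneg (tN_pos N).le hL.le
  calc localGibbsLaw σ (fun _ => 1) (fun _ => 0) (fun _ => 1) N (Φ N)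
        ({z | cellKey (rs N) (rs N) z = cellKey (rs N) (rs N) z₀} ∩
          {z | tN N / L < |slotSum (Φ N) τ (rs N) t₁ t₂ (fun x => gv x.2) h z|})
      ≤ localGibbsLaw σ (fun _ => 1) (fun _ => 0) (fun _ => 1) N (Φ N)
          {z | tN N / L < |slotSum (Φ N) τ (rs N) t₁ t₂ (fun x => gv x.2) h z|} := measure_mono inter_subset_right
    _ = 0 := hnull
    _ ≤ _ := zero_le

end Summit.AtomisticToContinuum.HydrodynamicLimit.Theorems.KickFairRelEquilibriumMesoLine

end
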